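import Mathlib
import Summits.Ventures.PercRepro2.SwGlueP1

/-!
# Row (SW) across a cut separating `{l, o}` from `h` — the theorem (blind cell PercRepro2, night-4 g4,
2026-08-24; NIGHT4-SIDE.md §5, placement P1)

With the map `glueMap` and its decoder `glueDec` of `SwGlueP1.lean`: on every leaf the image lies
in `Q(G)` and its blue cluster of `h` contains the red cluster of `h` of the source
(`glueMap_mem`, `glueMap_dom`), and the decoder makes the map injective (`glueDec_glueMap`).
Hence `sw_glue_sep_lo`: (SW)(G₁; l, c, o) ⟹ (SW)(G; l, h, o) — the ingredients being the
(SW-side) injection (`SwSideInj.exists_sideInj`) and the blue-side permutation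
(`SwGlueB.exists_bsidePerm`), both theorems.
-/

namespace Summit.Ventures.PercRepro2

namespace Glue

open Hull LocRows SwSide

open scoped Classical

variable {V : Type*} {E₁ E₂ : Type*} {ends₁ : E₁ → Sym2 V} {ends₂ : E₂ → Sym2 V} {c : V}
  {V₁ V₂ : Set V}

variable [Fintype E₁] [Fintype E₂] [DecidableEq E₁] [DecidableEq E₂]

section Main

variable (hg : IsGluing ends₁ ends₂ c V₁ V₂) {l h o : V} (hl : l ∈ V₁) (ho : o ∈ V₁) (hoc : o ≠ c)
  (hh : h ∈ V₂) (hhc : h ≠ c)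
  (φ : {ζ // ζ ∈ tgtU ends₁ l c {S : Set V | o ∈ S}} → Config E₁)
  (ψ : {ζ // ζ ∈ srcSide ends₁ l c o} → Config E₁)
  (θ : {ζ // ζ ∈ bsideSet ends₂ c h} → Config E₂)

omit [Fintype E₁] [Fintype E₂] [DecidableEq E₁] [DecidableEq E₂] in
include hg hh in
/-- Domination across the cut: the second sides dominate, and the first side of `c` dominates whenever
it is reached. -/
lemma dom_glue {ζ z : Config (E₁ ⊕ E₂)}
    (h₂ : cluster ends₂ (ζ ∘ Sum.inr) h ⊆ cluster ends₂ (blue z ∘ Sum.inr) h)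
    (h₁ : c ∈ cluster ends₂ (ζ ∘ Sum.inr) h →
      cluster ends₁ (ζ ∘ Sum.inl) c ⊆ cluster ends₁ (blue z ∘ Sum.inl) c) :
    cluster (glue ends₁ ends₂) ζ h ⊆ cluster (glue ends₁ ends₂) (blue z) h := by
  rw [cluster_glue_h hg hh, cluster_glue_h hg hh]
  rintro u (hu | ⟨hc, hu⟩)
  · exact Or.inl (h₂ hu)
  · exact Or.inr ⟨h₂ hc, h₁ hc hu⟩

/-- The `o`-status of a member of `srcSide`. -/
lemma o_of_mem_srcSide {w : Config E₁} (hw : w ∈ srcSide ends₁ l c o) :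
    o ∈ cluster ends₁ w l ∧ o ∉ cluster ends₁ (blue w) l := by
  simp only [srcSide, Finset.mem_filter, Finset.mem_univ, true_and, mem_rside_iff] at hw
  exact hw.1

/-- The `o`-status of a member of `tgtSide`. -/
lemma o_of_mem_tgtSide {w : Config E₁} (hw : w ∈ tgtSide ends₁ l c o) :
    o ∈ cluster ends₁ w l ∧ o ∉ cluster ends₁ (blue w) l := by
  simp only [tgtSide, Finset.mem_filter, Finset.mem_univ, true_and, mem_rside_iff] at hw
  exact hw.1

/-- The `o`-status of a member of `Q(G₁; l, c, o)`. -/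
lemma o_of_mem_tgtU₁ {w : Config E₁} (hw : w ∈ tgtU ends₁ l c {S : Set V | o ∈ S}) :
    o ∈ cluster ends₁ w l ∧ o ∉ cluster ends₁ (blue w) l := by
  simp only [tgtU, Finset.mem_filter, Finset.mem_univ, true_and, Set.mem_setOf_eq] at hw
  exact hw.2

variable {hg hl ho hoc hh hhc φ ψ θ}

/-- **The image lies in `Q(G)` and dominates** on every leaf. -/
theorem glueMap_mem_dom (hmemφ : ∀ y, φ y ∈ tgtU ends₁ l c {S : Set V | o ∈ S} ∧
      cluster ends₁ y.1 c ⊆ cluster ends₁ (blue (φ y)) c)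
    (hmemψ : ∀ y, ψ y ∈ tgtSide ends₁ l c o ∧ cluster ends₁ y.1 c ⊆ cluster ends₁ (blue (ψ y)) c)
    (hmemθ : ∀ y, θ y ∈ bsideSet ends₂ c h ∧ cluster ends₂ y.1 h ⊆ cluster ends₂ (blue (θ y)) h)
    (x : {ζ // ζ ∈ tgtU (glue ends₁ ends₂) l h {S : Set V | o ∈ S}}) :
    glueMap hg hl ho hoc hh hhc φ ψ θ x ∈ tgtU (glue ends₁ ends₂) l h {S : Set V | o ∈ S} ∧
      cluster (glue ends₁ ends₂) x.1 h ⊆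
        cluster (glue ends₁ ends₂) (blue (glueMap hg hl ho hoc hh hhc φ ψ θ x)) h := by
  have key := mem_tgtU_sep_lo hg hl ho hoc hh hhc
  obtain ⟨⟨hc1, hc2⟩, ho1, ho2⟩ := (key x.1).1 x.2
  by_cases hA : c ∈ cluster ends₁ (x.1 ∘ Sum.inl) l
  · have hT : c ∉ cluster ends₂ (x.1 ∘ Sum.inr) h := fun hT => hc1 ⟨hA, hT⟩
    by_cases hB : c ∈ cluster ends₁ (blue (x.1 ∘ Sum.inl)) l
    · -- (K, n)
      have hT' : c ∉ cluster ends₂ (blue (x.1 ∘ Sum.inr)) h := fun hT' => hc2 ⟨hB, hT'⟩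
      rw [glueMap_KN x hA hB]
      refine ⟨(key _).2 ⟨⟨?_, ?_⟩, ?_, ?_⟩, dom_glue hg hh ?_ (fun hc => absurd hc hT)⟩
      · rw [swap₂_inl, swap₂_inr]; exact fun h' => hT' h'.2
      · rw [swap₂_inl, swap₂_inr, blue_blue]; exact fun h' => hT h'.2
      · rw [swap₂_inl]; exact ho1
      · rw [swap₂_inl]; exact ho2
      · rw [blue_swap₂_inr]
    · by_cases hT' : c ∈ cluster ends₂ (blue (x.1 ∘ Sum.inr)) h
      · by_cases hr : ∃ s, ψ s = x.1 ∘ Sum.inl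
        · -- (R, b) inside the image of `ψ`
          rw [glueMap_RB_in x hA hB hT' hr]
          have hw := invOn_mem ψ hr
          obtain ⟨hwA, hwB⟩ := status_of_mem_srcSide hw
          obtain ⟨hwo1, hwo2⟩ := o_of_mem_srcSide hw
          refine ⟨(key _).2 ⟨⟨?_, ?_⟩, ?_, ?_⟩, dom_glue hg hh ?_ (fun hc => absurd hc hT)⟩
          · rw [pair_inl]; exact fun h' => hwA h'.1
          · rw [pair_inr, blue_blue]; exact fun h' => hT h'.2
          · rw [pair_inl]; exact hwo1
          · rw [pair_inl]; exact hwo2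
          · rw [blue_pair, pair_inr, blue_blue]
        · -- (R, b) off the image of `ψ`
          rw [glueMap_RB_out x hA hB hT' hr]
          obtain ⟨hθm, hθsub⟩ := hmemθ ⟨x.1 ∘ Sum.inr, mem_bsideSet_of hg hl ho hoc hh hhc x.2 hA hT'⟩
          obtain ⟨_, hθ2⟩ := status_of_mem_bsideSet hθm
          refine ⟨(key _).2 ⟨⟨?_, ?_⟩, ?_, ?_⟩, dom_glue hg hh ?_ (fun hc => absurd hc hT)⟩
          · rw [pair_inr]; exact fun h' => hθ2 h'.2
          · rw [pair_inl]; exact fun h' => hB h'.1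
          · rw [pair_inl]; exact ho1
          · rw [pair_inl]; exact ho2
          · rw [blue_pair, pair_inr]; exact hθsub
      · -- (R, n)
        rw [glueMap_RN x hA hB hT']
        refine ⟨(key _).2 ⟨⟨?_, ?_⟩, ?_, ?_⟩, dom_glue hg hh ?_ (fun hc => absurd hc hT)⟩
        · rw [swap₂_inr]; exact fun h' => hT' h'.2
        · rw [swap₂_inl]; exact fun h' => hB h'.1
        · rw [swap₂_inl]; exact ho1
        · rw [swap₂_inl]; exact ho2
        · rw [blue_swap₂_inr]
  · by_cases hB : c ∈ cluster ends₁ (blue (x.1 ∘ Sum.inl)) l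
    · have hT' : c ∉ cluster ends₂ (blue (x.1 ∘ Sum.inr)) h := fun hT' => hc2 ⟨hB, hT'⟩
      by_cases hT : c ∈ cluster ends₂ (x.1 ∘ Sum.inr) h
      · -- (B, r)
        rw [glueMap_BR x hA hB hT]
        obtain ⟨hwm, hwsub⟩ := hmemψ ⟨x.1 ∘ Sum.inl, mem_srcSide_of hg hl ho hoc hh hhc x.2 hA hB⟩
        obtain ⟨_, hwB⟩ := status_of_mem_tgtSide hwm
        obtain ⟨hwo1, hwo2⟩ := o_of_mem_tgtSide hwm
        refine ⟨(key _).2 ⟨⟨?_, ?_⟩, ?_, ?_⟩, dom_glue hg hh ?_ ?_⟩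
        · rw [pair_inr]; exact fun h' => hT' h'.2
        · rw [pair_inl]; exact fun h' => hwB h'.1
        · rw [pair_inl]; exact hwo1
        · rw [pair_inl]; exact hwo2
        · rw [blue_pair, pair_inr, blue_blue]
        · intro _; rw [blue_pair, pair_inl]; exact hwsub
      · -- (B, n)
        rw [glueMap_BN x hA hB hT]
        refine ⟨(key _).2 ⟨⟨?_, ?_⟩, ?_, ?_⟩, dom_glue hg hh ?_ (fun hc => absurd hc hT)⟩
        · rw [swap₂_inl]; exact fun h' => hA h'.1
        · rw [swap₂_inr, blue_blue]; exact fun h' => hT h'.2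
        · rw [swap₂_inl]; exact ho1
        · rw [swap₂_inl]; exact ho2
        · rw [blue_swap₂_inr]
    · by_cases hT : c ∈ cluster ends₂ (x.1 ∘ Sum.inr) h
      · -- (N, T)
        rw [glueMap_NT x hA hB hT]
        obtain ⟨hwm, hwsub⟩ := hmemφ ⟨x.1 ∘ Sum.inl, mem_tgtU₁_of hg hl ho hoc hh hhc x.2 hA hB⟩
        obtain ⟨hwA, hwB⟩ := status_of_mem_tgtU₁ hwm
        obtain ⟨hwo1, hwo2⟩ := o_of_mem_tgtU₁ hwm
        refine ⟨(key _).2 ⟨⟨?_, ?_⟩, ?_, ?_⟩, dom_glue hg hh ?_ ?_⟩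
        · rw [pair_inl]; exact fun h' => hwA h'.1
        · rw [pair_inl]; exact fun h' => hwB h'.1
        · rw [pair_inl]; exact hwo1
        · rw [pair_inl]; exact hwo2
        · rw [blue_pair, pair_inr, blue_blue]
        · intro _; rw [blue_pair, pair_inl]; exact hwsub
      · -- (N, ¬T)
        rw [glueMap_NN x hA hB hT]
        refine ⟨(key _).2 ⟨⟨?_, ?_⟩, ?_, ?_⟩, dom_glue hg hh ?_ (fun hc => absurd hc hT)⟩
        · rw [swap₂_inl]; exact fun h' => hA h'.1
        · rw [swap₂_inl]; exact fun h' => hB h'.1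
        · rw [swap₂_inl]; exact ho1
        · rw [swap₂_inl]; exact ho2
        · rw [blue_swap₂_inr]

end Main

/-- **(SW) across a cut separating `{l, o}` from `h`**: (SW) on the `{l, o}`-side with the cut vertex
as the marked `h` gives (SW) on the glued graph; the other ingredients — the (SW-side) injection and
the blue-side permutation — are theorems. -/
theorem sw_glue_sep_lo (hg : IsGluing ends₁ ends₂ c V₁ V₂) {l h o : V} (hl : l ∈ V₁) (ho : o ∈ V₁)
    (hoc : o ≠ c) (hh : h ∈ V₂) (hhc : h ≠ c) (h₁ : Sw ends₁ l c o) :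
    Sw (glue ends₁ ends₂) l h o := by
  obtain ⟨φ, hφ, hmemφ⟩ := h₁
  obtain ⟨ψ, hψ, hmemψ⟩ := exists_sideInj ends₁ l c o
  obtain ⟨θ, hθ, hmemθ⟩ := exists_bsidePerm ends₂ c h
  refine ⟨glueMap hg hl ho hoc hh hhc φ ψ θ, ?_, glueMap_mem_dom hmemφ hmemψ hmemθ⟩
  intro x y hxy
  apply Subtype.ext
  have hd := glueDec_glueMap (hg := hg) (hl := hl) (ho := ho) (hoc := hoc) (hh := hh) (hhc := hhc)
    (φ := φ) (ψ := ψ) (θ := θ)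
  rw [← hd x hφ (fun y => (hmemφ y).1) hψ (fun y => (hmemψ y).1) hθ (fun y => (hmemθ y).1), hxy,
    hd y hφ (fun y => (hmemφ y).1) hψ (fun y => (hmemψ y).1) hθ (fun y => (hmemθ y).1)]

end Glue

end Summit.Ventures.PercRepro2
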